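import Literature.AlgebraicGeometry.GroupSchemes.WeilGluingStepMeasureChart
import Literature.AlgebraicGeometry.GroupSchemes.BirationalGroupLawGenericLeftTranslate
import Literature.AlgebraicGeometry.GroupSchemes.BirationalGroupLawTranslate
import Literature.AlgebraicGeometry.GroupSchemes.SectionsThroughFibreDenseOpens
import HarnessLib

/-!
# Artin's gluing step increases the measure: the bad slice point becomes defined in `V ∪ V·s`
# (Artin, *Néron models*, §2 p. 222 «replacing `V′` by `V′ ∪ V′_s` increases `V′` and `W`»)

Topic `Literature/AlgebraicGeometry/GroupSchemes`, namespace `Literature.AlgebraicGeometry.GroupSchemes`.  THEOREMS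
ONLY (no definition, no named fact, no instance, no `sorry`).  Cell `hodgecm-mathlib`, road W (r₀), (W1) step (G2c)
«StageStep, measure increase», piece (G2c-pt), layer C3 = ASSEMBLY of the chart ★ `WeilGluingStepMeasureChart`
(layer C1) with the choice of the auxiliary section (★ `BirationalGroupLaw.fibre_subset_closure_leftTranslateDom`,
layer C2, B-p20; ★ `GroupSchemes.exists_open_forall_section_lift_mem`) and the non-emptiness configuration from
strictness (layer C1b, inside).

STATEMENT.  `L` a STRICT birational group law on `𝒳 → S` (preirreducible fibres `hirr`, sections dense in every
fibre `hsec`, `𝒳 ×_S 𝒳` preirreducible), `L′` a STRICT one on the stage `𝒱 → S` (universally open, geometrically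
irreducible fibres), `j : 𝒳 → 𝒱` over `S` with fibrewise-dense image intertwining the laws through `φ`, a section `s`
with the translate chart `(σ′, A, e, ρ)` of `s′ = j ∘ s` on `𝒱` (★ `exists_rightTranslate'`) and the glued stage
`i₁, i₂ : 𝒱 → 𝒲`, `ρ ≫ i₁ = A.ι ≫ i₂` (★ `exists_selfGluing`).  THEN for EVERY point `x` of `𝒳` the slice point
`σ_s(x) = (x, s(πx))` lies in the domain of definition of `(dom, mul ≫ j ≫ i₁) : 𝒳 ×_S 𝒳 ⤏ 𝒲` — in particular the
bad point of the step does (★ `measure_lt_measure_comp_of_mem`'s `hin`), so the measure strictly increases.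
PROOF.  Choose a section `y = j ∘ y₀` with `(s′ t, y t) ∈ dom′` and `(j x, s′ t · y t) ∈ dom′` (`t = π x`): the set of
such `y t` is dense in the appropriate fibre by layer C2, sections through it exist by `hsec` and the fibrewise density
of `j(𝒳)`; let `S₀ = (s′, y)⁻¹ dom′ ∋ t` and `u = s′·y` on `S₀`.  The chart of layer C1 at the `T₀`-point
`𝒳₁ = {a over S₀ : (ja, u) ∈ dom′} ∋ x`; its non-emptiness configuration is a point of the irreducible fibre `𝒳_t`
where moreover `(a, s) ∈ dom` (strictness of `L`, slice of `s`) and `(j(a·s), y) ∈ dom′` (the translate `a ↦ a·s` has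
fibrewise-dense image, strictness of `L′` on the slice of `y`, density of `j(𝒳)`).
HC_CM is proved only modulo the 7 printed citations until rung 0 closes; banked leaf, no floor change.

## References
* [Artin1986NeronModels] M. Artin, *Néron models*, in Cornell–Silverman, *Arithmetic Geometry* (1986), §2, Lemma 2.4
  and the proof of Thm. (1.12), p. 222–223.
* [EdixhovenRomagny] B. Edixhoven, M. Romagny, *Group schemes out of birational group laws, Néron models*, Panor.
  Synthèses 47 (2015), Def. 3.4, Lemmas 3.19–3.21.
-/

noncomputable section

set_option backward.isDefEq.respectTransparency false

universe u

namespace Literature.AlgebraicGeometry.GroupSchemes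

open CategoryTheory Limits _root_.AlgebraicGeometry MonoidalCategory CartesianMonoidalCategory TopologicalSpace
open Literature.AlgebraicGeometry.RationalMaps

/-! ## §1. Plumbing -/

/-- A morphism whose image lies in an open factors through it. [folklore] -/
private theorem exists_lift_opens' {X T : Scheme.{u}} (O : X.Opens) (g : T ⟶ X) (h : ∀ t : T, g.base t ∈ O) :
    ∃ l : T ⟶ (O : Scheme.{u}), l ≫ O.ι = g := by
  refine ⟨IsOpenImmersion.lift O.ι g ?_, IsOpenImmersion.lift_fac _ _ _⟩
  rintro _ ⟨t, rfl⟩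
  rw [Scheme.Opens.range_ι]
  exact h t

/-- Evaluation of a composition identity at a point. [folklore] -/
private theorem base_comp_apply' {X Y Z : Scheme.{u}} {f : X ⟶ Y} {g : Y ⟶ Z} {h : X ⟶ Z} (e : f ≫ g = h)
    (x : X) : g.base (f.base x) = h.base x := by
  rw [← e, Scheme.Hom.comp_base, TopCat.coe_comp, Function.comp_apply]

/-- An open set meeting a fibre meets any set dense in that fibre. [folklore] -/
private theorem nonempty_inter_of_fibrewiseDense {X Y : Scheme.{u}} {p : Y ⟶ X} {U : Set Y}
    (hU : IsFibrewiseDense p U) {O : Set Y} (hO : IsOpen O) {t : X} (h : (O ∩ p.base ⁻¹' {t}).Nonempty) :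
    (O ∩ U ∩ p.base ⁻¹' {t}).Nonempty := by
  obtain ⟨v, hvO, hvt⟩ := h
  have hv : v ∈ closure (U ∩ p.base ⁻¹' {t}) := hU t hvt
  rw [mem_closure_iff] at hv
  obtain ⟨w, hwO, hwU, hwt⟩ := hv O hO hvO
  exact ⟨w, ⟨hwO, hwU⟩, hwt⟩

/-! ## §2. The measure increases -/

variable {S : Scheme.{u}} {𝒳 𝒱 𝒲 : Over S} (L : BirationalGroupLaw 𝒳) (L' : BirationalGroupLaw 𝒱) (j : 𝒳 ⟶ 𝒱)
  [PreirreducibleSpace ↑(𝒳 ⊗ 𝒳).left] [UniversallyOpen 𝒱.hom] [GeometricallyIrreducible 𝒱.hom]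
  (hL : L.IsStrict) (hL' : L'.IsStrict)
  (hirr : ∀ t : S, IsPreirreducible (𝒳.hom.base ⁻¹' {t}))
  (hsec : ∀ (x : 𝒳.left) (Ω : 𝒳.left.Opens), x ∈ Ω →
    ∃ a : S ⟶ 𝒳.left, a ≫ 𝒳.hom = 𝟙 S ∧ ∃ t : S, a.base t ∈ Ω ∧ 𝒳.hom.base (a.base t) = 𝒳.hom.base x)
  (hjd : IsFibrewiseDense 𝒱.hom (Set.range j.left.base))
  (φ : (L.dom : Scheme.{u}) ⟶ (L'.dom : Scheme.{u}))
  (hφ₁ : φ ≫ L'.dom.ι = L.dom.ι ≫ (j ⊗ₘ j).left) (hφ₂ : φ ≫ L'.mul = L.mul ≫ j.left)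
  (i₁ i₂ : 𝒱 ⟶ 𝒲)
  (s : S ⟶ 𝒳.left) (hs : s ≫ 𝒳.hom = 𝟙 S)
  (σ' : 𝒱.left ⟶ (𝒱 ⊗ 𝒱).left) (hσ'1 : σ' ≫ (fst 𝒱 𝒱).left = 𝟙 _)
  (hσ'2 : σ' ≫ (snd 𝒱 𝒱).left = 𝒱.hom ≫ s ≫ j.left)
  {A : 𝒱.left.Opens} (e : (A : Scheme.{u}) ⟶ (L'.dom : Scheme.{u})) (ρ : (A : Scheme.{u}) ⟶ 𝒱.left)
  (he : e ≫ L'.dom.ι = A.ι ≫ σ') (hρ : ρ = e ≫ L'.mul) (hρS : ρ ≫ 𝒱.hom = A.ι ≫ 𝒱.hom)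
  (hA : ∀ v : 𝒱.left, σ'.base v ∈ L'.dom → v ∈ A)
  (hglue : ρ ≫ i₁.left = A.ι ≫ i₂.left)

include hL hL' hirr hsec hjd hφ₁ hφ₂ hs hσ'1 hσ'2 he hρ hρS hA hglue in
/-- **Artin's gluing step increases the measure** ([Artin1986NeronModels] §2 p. 222: «replacing `V′` by `V′ ∪ V′_s`
… increases `V′` and `W`»; Lemma 2.4).  In the setting of the module docstring, for EVERY point `x` of `𝒳` the slice
point `σ_s(x) = (x, s(πx))` of `𝒳 ×_S 𝒳` lies in the domain of definition of the rational map
`(dom, mul ≫ j ≫ i₁) : 𝒳 ×_S 𝒳 ⤏ 𝒲` into the glued stage `𝒲 = 𝒱 ∪_A 𝒱` — the `hin` of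
★ `measure_lt_measure_comp_of_mem` at the bad point of the step.  (Assembly: auxiliary section `y` by layer C2 +
★ `exists_open_forall_section_lift_mem` + `hsec`; partial section `u = s′·y` on `S₀ = (s′, y)⁻¹ dom′`; chart of layer
C1; non-emptiness configuration from strictness in the irreducible fibre `𝒳_{πx}`.)
[cite: Artin1986NeronModels, §2, Lemma 2.4 and p. 222 «this increases W»] [cite: EdixhovenRomagny, Def. 3.4, Lemmas 3.19–3.21] -/
theorem BirationalGroupLaw.sectionSlice_mem_domain_comp (x : 𝒳.left) :
    (lift (𝟙 𝒳) (Over.homMk (𝒳.hom ≫ s) (by rw [Category.assoc, hs, Category.comp_id]) : 𝒳 ⟶ 𝒳)).left.base x ∈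
      (Scheme.PartialMap.toRationalMap
        (⟨L.dom, L.dense_dom.dense, L.mul ≫ (j ≫ i₁).left⟩ : (𝒳 ⊗ 𝒳).left.PartialMap 𝒲.left)).domain := by
  -- ### notation and coordinate helpers
  have hextX : ∀ {T : Scheme.{u}} (f g : T ⟶ (𝒳 ⊗ 𝒳).left),
      f ≫ (fst 𝒳 𝒳).left = g ≫ (fst 𝒳 𝒳).left → f ≫ (snd 𝒳 𝒳).left = g ≫ (snd 𝒳 𝒳).left → f = g :=
    fun f g h1 h2 => pullback.hom_ext h1 h2
  have hextV : ∀ {T : Scheme.{u}} (f g : T ⟶ (𝒱 ⊗ 𝒱).left),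
      f ≫ (fst 𝒱 𝒱).left = g ≫ (fst 𝒱 𝒱).left → f ≫ (snd 𝒱 𝒱).left = g ≫ (snd 𝒱 𝒱).left → f = g :=
    fun f g h1 h2 => pullback.hom_ext h1 h2
  have hextW : ∀ {T : Scheme.{u}} (f g : T ⟶ pullback 𝒱.hom (𝒱 ⊗ 𝒱).hom),
      f ≫ pullback.fst _ _ = g ≫ pullback.fst _ _ → f ≫ pullback.snd _ _ = g ≫ pullback.snd _ _ → f = g :=
    fun f g h1 h2 => pullback.hom_ext h1 h2
  have hfstS : (fst 𝒳 𝒳).left ≫ 𝒳.hom = (𝒳 ⊗ 𝒳).hom := Over.w (fst 𝒳 𝒳)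
  have hsndS : (snd 𝒳 𝒳).left ≫ 𝒳.hom = (𝒳 ⊗ 𝒳).hom := Over.w (snd 𝒳 𝒳)
  have hfstS' : (fst 𝒱 𝒱).left ≫ 𝒱.hom = (𝒱 ⊗ 𝒱).hom := Over.w (fst 𝒱 𝒱)
  have hsndS' : (snd 𝒱 𝒱).left ≫ 𝒱.hom = (𝒱 ⊗ 𝒱).hom := Over.w (snd 𝒱 𝒱)
  have hjS : j.left ≫ 𝒱.hom = 𝒳.hom := Over.w j
  have hjj1 : (j ⊗ₘ j).left ≫ (fst 𝒱 𝒱).left = (fst 𝒳 𝒳).left ≫ j.left :=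
    congrArg CommaMorphism.left (tensorHom_fst j j)
  have hjj2 : (j ⊗ₘ j).left ≫ (snd 𝒱 𝒱).left = (snd 𝒳 𝒳).left ≫ j.left :=
    congrArg CommaMorphism.left (tensorHom_snd j j)
  have hs' : (s ≫ j.left) ≫ 𝒱.hom = 𝟙 S := by rw [Category.assoc, hjS, hs]
  have hs'' : s ≫ j.left ≫ 𝒱.hom = 𝟙 S := by rw [hjS, hs]
  -- the slice `σX = (𝟙, s ∘ π)` of `s` on `𝒳`
  set σX : 𝒳 ⟶ 𝒳 ⊗ 𝒳 := lift (𝟙 𝒳) (Over.homMk (𝒳.hom ≫ s) (by rw [Category.assoc, hs, Category.comp_id]))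
    with hσXdef
  have hσX1 : σX.left ≫ (fst 𝒳 𝒳).left = 𝟙 _ := by
    change (σX ≫ fst 𝒳 𝒳).left = _; rw [hσXdef, lift_fst]; rfl
  have hσX2 : σX.left ≫ (snd 𝒳 𝒳).left = 𝒳.hom ≫ s := by
    change (σX ≫ snd 𝒳 𝒳).left = _; rw [hσXdef, lift_snd]; rfl
  have hσXS : σX.left ≫ (𝒳 ⊗ 𝒳).hom = 𝒳.hom := Over.w σX
  set t : S := 𝒳.hom.base x with htdef
  -- ### Step 1: CHOICE OF THE AUXILIARY SECTION `y` (layer C2 + sections through fibre-dense opens)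
  -- the point `p₀ = (s′ t, j x)` of `𝒱 ×_S 𝒱` as the image of `j x` under `σ″ = (s′ ∘ π, 𝟙)`
  obtain ⟨σ'', hσ''1, hσ''2⟩ : ∃ σ'' : 𝒱.left ⟶ (𝒱 ⊗ 𝒱).left,
      σ'' ≫ (fst 𝒱 𝒱).left = 𝒱.hom ≫ s ≫ j.left ∧ σ'' ≫ (snd 𝒱 𝒱).left = 𝟙 _ := by
    have w : (𝒱.hom ≫ s ≫ j.left) ≫ 𝒱.hom = 𝟙 _ ≫ 𝒱.hom := by
      rw [Category.assoc, hs', Category.comp_id, Category.id_comp]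
    exact ⟨pullback.lift _ _ w, pullback.lift_fst _ _ _, pullback.lift_snd _ _ _⟩
  have hσ''S : σ'' ≫ (𝒱 ⊗ 𝒱).hom = 𝒱.hom := by rw [← hsndS', reassoc_of% hσ''2]
  set p₀ : ↑(𝒱 ⊗ 𝒱).left := σ''.base (j.left.base x) with hp₀def
  have hp₀t : (𝒱 ⊗ 𝒱).hom.base p₀ = t := by
    rw [hp₀def, base_comp_apply' hσ''S, base_comp_apply' hjS]
  -- the coordinate maps `α′ = (a, v)` and `Θ′ = (b, a·v)` on `W′ = 𝒱 ×_S (𝒱 ×_S 𝒱)` for layer C2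
  obtain ⟨α', hα'1, hα'2⟩ : ∃ α' : pullback 𝒱.hom (𝒱 ⊗ 𝒱).hom ⟶ (𝒱 ⊗ 𝒱).left,
      α' ≫ (fst 𝒱 𝒱).left = pullback.snd 𝒱.hom (𝒱 ⊗ 𝒱).hom ≫ (fst 𝒱 𝒱).left ∧
      α' ≫ (snd 𝒱 𝒱).left = pullback.fst 𝒱.hom (𝒱 ⊗ 𝒱).hom := by
    have w : (pullback.snd 𝒱.hom (𝒱 ⊗ 𝒱).hom ≫ (fst 𝒱 𝒱).left) ≫ 𝒱.hom =
        pullback.fst 𝒱.hom (𝒱 ⊗ 𝒱).hom ≫ 𝒱.hom := by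
      rw [Category.assoc, hfstS', pullback.condition]
    exact ⟨pullback.lift _ _ w, pullback.lift_fst _ _ _, pullback.lift_snd _ _ _⟩
  have hres : (α' ∣_ L'.dom) ≫ L'.dom.ι = (α' ⁻¹ᵁ L'.dom).ι ≫ α' := morphismRestrict_ι _ _
  have hα'S : α' ≫ (𝒱 ⊗ 𝒱).hom = pullback.snd 𝒱.hom (𝒱 ⊗ 𝒱).hom ≫ (𝒱 ⊗ 𝒱).hom := by
    have h := congrArg (· ≫ 𝒱.hom) hα'1
    simpa only [Category.assoc, hfstS'] using h
  obtain ⟨Θ', hΘ'1, hΘ'2⟩ : ∃ Θ' : ((α' ⁻¹ᵁ L'.dom : (pullback 𝒱.hom (𝒱 ⊗ 𝒱).hom).Opens) : Scheme.{u}) ⟶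
      (𝒱 ⊗ 𝒱).left,
      Θ' ≫ (fst 𝒱 𝒱).left = (α' ⁻¹ᵁ L'.dom).ι ≫ pullback.snd 𝒱.hom (𝒱 ⊗ 𝒱).hom ≫ (snd 𝒱 𝒱).left ∧
      Θ' ≫ (snd 𝒱 𝒱).left = (α' ∣_ L'.dom) ≫ L'.mul := by
    have w : ((α' ⁻¹ᵁ L'.dom).ι ≫ pullback.snd 𝒱.hom (𝒱 ⊗ 𝒱).hom ≫ (snd 𝒱 𝒱).left) ≫ 𝒱.hom =
        ((α' ∣_ L'.dom) ≫ L'.mul) ≫ 𝒱.hom := by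
      simp only [Category.assoc]
      rw [hsndS', L'.mul_comp, reassoc_of% hres, hα'S]
    exact ⟨pullback.lift _ _ w, pullback.lift_fst _ _ _, pullback.lift_snd _ _ _⟩
  -- layer C2 at `p₀`, then the section device
  have hdense := L'.fibre_subset_closure_leftTranslateDom hL' α' hα'1 hα'2 Θ' hΘ'1 hΘ'2 p₀
  have hfib : (𝒱.hom.base ⁻¹' {(𝒱 ⊗ 𝒱).hom.base p₀}).Nonempty :=
    ⟨j.left.base x, by rw [hp₀t]; exact base_comp_apply' hjS x⟩
  obtain ⟨Ω, hΩne, hΩ⟩ := exists_open_forall_section_lift_mem 𝒱.hom (𝒱 ⊗ 𝒱).hom p₀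
    ((α' ⁻¹ᵁ L'.dom).ι ''ᵁ (Θ' ⁻¹ᵁ L'.dom)) hdense hfib
  rw [hp₀t] at hΩne hΩ
  -- a section `y₀` of `𝒳` with `j (y₀ t) ∈ Ω` (fibrewise density of `j(𝒳)` + `hsec`)
  obtain ⟨v₁, ⟨hv₁Ω, a₁', rfl⟩, hv₁t⟩ := nonempty_inter_of_fibrewiseDense hjd Ω.2 hΩne
  have ha₁'t : 𝒳.hom.base a₁' = t := by rw [← base_comp_apply' hjS]; exact hv₁t
  obtain ⟨y₀, hy₀, hy₀Ω⟩ := exists_section_apply_mem 𝒳.hom hsec t (j.left ⁻¹ᵁ Ω) ⟨a₁', hv₁Ω, ha₁'t⟩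
  have hy : (y₀ ≫ j.left) ≫ 𝒱.hom = 𝟙 S := by rw [Category.assoc, hjS, hy₀]
  -- the point `P = (y t, p₀)` of `W′` lies in `O₂′`
  obtain ⟨Pt, hPtΘ, hPt⟩ := hΩ (y₀ ≫ j.left) hy hy₀Ω
  -- ### Step 2: the open `S₀ = (s′, y)⁻¹ dom′ ∋ t` and the partial section `u = s′·y`
  obtain ⟨ps, hps1, hps2⟩ : ∃ ps : S ⟶ (𝒱 ⊗ 𝒱).left,
      ps ≫ (fst 𝒱 𝒱).left = s ≫ j.left ∧ ps ≫ (snd 𝒱 𝒱).left = y₀ ≫ j.left := by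
    have w : (s ≫ j.left) ≫ 𝒱.hom = (y₀ ≫ j.left) ≫ 𝒱.hom := by rw [hs', hy]
    exact ⟨pullback.lift _ _ w, pullback.lift_fst _ _ _, pullback.lift_snd _ _ _⟩
  set S₀ : S.Opens := ps ⁻¹ᵁ L'.dom with hS₀def
  obtain ⟨qu, hqu⟩ : ∃ qu : (S₀ : Scheme.{u}) ⟶ (L'.dom : Scheme.{u}), qu ≫ L'.dom.ι = S₀.ι ≫ ps :=
    exists_lift_opens' L'.dom (S₀.ι ≫ ps) fun w => w.2
  have hqu₁ : qu ≫ L'.dom.ι ≫ (fst 𝒱 𝒱).left = S₀.ι ≫ s ≫ j.left := by rw [reassoc_of% hqu, hps1]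
  have hqu₂ : qu ≫ L'.dom.ι ≫ (snd 𝒱 𝒱).left = S₀.ι ≫ y₀ ≫ j.left := by rw [reassoc_of% hqu, hps2]
  have hu : qu ≫ L'.mul ≫ 𝒱.hom = S₀.ι := by
    rw [L'.mul_comp, ← hfstS', reassoc_of% hqu₁, hs'', Category.comp_id]
  -- the morphism `Λ = (y ∘ π, 𝟙) : 𝒱 ×_S 𝒱 → W′` of the section device, and `μ = Λ ∘ σ″ ∘ j : 𝒳 → W′`
  set Λ : (𝒱 ⊗ 𝒱).left ⟶ pullback 𝒱.hom (𝒱 ⊗ 𝒱).hom :=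
    pullback.lift ((𝒱 ⊗ 𝒱).hom ≫ (y₀ ≫ j.left)) (𝟙 _)
      (by rw [Category.assoc, hy, Category.comp_id, Category.id_comp]) with hΛdef
  have hΛ1 : Λ ≫ pullback.fst 𝒱.hom (𝒱 ⊗ 𝒱).hom = (𝒱 ⊗ 𝒱).hom ≫ y₀ ≫ j.left := pullback.lift_fst _ _ _
  have hΛ2 : Λ ≫ pullback.snd 𝒱.hom (𝒱 ⊗ 𝒱).hom = 𝟙 _ := pullback.lift_snd _ _ _
  have hμα : j.left ≫ σ'' ≫ Λ ≫ α' = 𝒳.hom ≫ ps := by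
    refine hextV _ _ ?_ ?_
    · simp only [Category.assoc]
      rw [hα'1, reassoc_of% hΛ2, hσ''1, reassoc_of% hjS, hps1]
    · simp only [Category.assoc]
      rw [hα'2, hΛ1, reassoc_of% hσ''S, reassoc_of% hjS, hps2]
  have hPα : α'.base (Λ.base (σ''.base (j.left.base x))) ∈ L'.dom := by
    rw [show Λ.base (σ''.base (j.left.base x)) = (α' ⁻¹ᵁ L'.dom).ι.base Pt from hPt.symm]
    exact Pt.2
  have ht₀ : t ∈ S₀ := by
    change (𝒳.hom ≫ ps).base x ∈ L'.dom
    rw [← base_comp_apply' hμα]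
    exact hPα
  -- ### Step 3: the `T₀`-point `𝒳₁ = {a over S₀ : (ja, u(πa)) ∈ dom′} ∋ x` and the chart of layer C1
  set 𝒳₀ : 𝒳.left.Opens := 𝒳.hom ⁻¹ᵁ S₀ with h𝒳₀def
  let κ₀ : (𝒳₀ : Scheme.{u}) ⟶ (S₀ : Scheme.{u}) := 𝒳.hom.resLE S₀ 𝒳₀ le_rfl
  have hκ₀ : κ₀ ≫ S₀.ι = 𝒳₀.ι ≫ 𝒳.hom := Scheme.Hom.resLE_comp_ι _ _
  obtain ⟨ζ, hζ1, hζ2⟩ : ∃ ζ : (𝒳₀ : Scheme.{u}) ⟶ (𝒱 ⊗ 𝒱).left,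
      ζ ≫ (fst 𝒱 𝒱).left = 𝒳₀.ι ≫ j.left ∧ ζ ≫ (snd 𝒱 𝒱).left = κ₀ ≫ qu ≫ L'.mul := by
    have w : (𝒳₀.ι ≫ j.left) ≫ 𝒱.hom = (κ₀ ≫ qu ≫ L'.mul) ≫ 𝒱.hom := by
      simp only [Category.assoc]
      rw [hjS, hu, hκ₀]
    exact ⟨pullback.lift _ _ w, pullback.lift_fst _ _ _, pullback.lift_snd _ _ _⟩
  set 𝒳₁ : (𝒳₀ : Scheme.{u}).Opens := ζ ⁻¹ᵁ L'.dom with h𝒳₁def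
  obtain ⟨q, hq⟩ : ∃ q : (𝒳₁ : Scheme.{u}) ⟶ (L'.dom : Scheme.{u}), q ≫ L'.dom.ι = 𝒳₁.ι ≫ ζ :=
    exists_lift_opens' L'.dom (𝒳₁.ι ≫ ζ) fun w => w.2
  have hτS : (𝒳₁.ι ≫ κ₀) ≫ S₀.ι = (𝒳₁.ι ≫ 𝒳₀.ι) ≫ 𝒳.hom := by rw [Category.assoc, hκ₀, Category.assoc]
  have hq₁ : q ≫ L'.dom.ι ≫ (fst 𝒱 𝒱).left = (𝒳₁.ι ≫ 𝒳₀.ι) ≫ j.left := by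
    rw [reassoc_of% hq, hζ1, Category.assoc]
  have hq₂ : q ≫ L'.dom.ι ≫ (snd 𝒱 𝒱).left = (𝒳₁.ι ≫ κ₀) ≫ qu ≫ L'.mul := by
    rw [reassoc_of% hq, hζ2, Category.assoc]
  -- `x ∈ 𝒳₁`: the lift `μ̃ : 𝒳₀ → E′` of `μ` has `Θ′ ∘ μ̃ = ζ`, and `μ̃ x = Pt`
  have hx₀ : x ∈ 𝒳₀ := ht₀
  obtain ⟨μt, hμt⟩ : ∃ μt : (𝒳₀ : Scheme.{u}) ⟶ ((α' ⁻¹ᵁ L'.dom : (pullback 𝒱.hom (𝒱 ⊗ 𝒱).hom).Opens) :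
      Scheme.{u}), μt ≫ (α' ⁻¹ᵁ L'.dom).ι = 𝒳₀.ι ≫ j.left ≫ σ'' ≫ Λ := by
    refine exists_lift_opens' _ _ fun a => ?_
    change α'.base ((𝒳₀.ι ≫ j.left ≫ σ'' ≫ Λ).base a) ∈ L'.dom
    rw [base_comp_apply' (show (𝒳₀.ι ≫ j.left ≫ σ'' ≫ Λ) ≫ α' = 𝒳₀.ι ≫ 𝒳.hom ≫ ps from by
        simp only [Category.assoc]; rw [hμα])]
    exact a.2
  have hμtα : μt ≫ (α' ∣_ L'.dom) = κ₀ ≫ qu := by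
    rw [← cancel_mono L'.dom.ι, Category.assoc, hres, reassoc_of% hμt]
    simp only [Category.assoc]
    rw [hμα, hqu, reassoc_of% hκ₀]
  have hΘμ : μt ≫ Θ' = ζ := by
    refine hextV _ _ ?_ ?_
    · rw [Category.assoc, hΘ'1, reassoc_of% hμt, reassoc_of% hΛ2, hσ''2, Category.comp_id, hζ1]
    · rw [Category.assoc, hΘ'2, reassoc_of% hμtα, hζ2]
  have hμtx : μt.base ⟨x, hx₀⟩ = Pt := by
    apply (α' ⁻¹ᵁ L'.dom).ι.isOpenEmbedding.injective
    rw [base_comp_apply' hμt]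
    exact hPt.symm
  have hx₁ : (⟨x, hx₀⟩ : ↥𝒳₀) ∈ 𝒳₁ := by
    change ζ.base ⟨x, hx₀⟩ ∈ L'.dom
    rw [← base_comp_apply' hΘμ, hμtx]
    exact hPtΘ
  -- the non-emptiness configuration (layer C1b, below) and the chart of layer C1
  suffices hne : ∃ (T₁ : Scheme.{u}) (_ : Nonempty T₁) (τ₁ : T₁ ⟶ 𝒳.left) (τ₁S : T₁ ⟶ (S₀ : Scheme.{u}))
      (q' qy : T₁ ⟶ (L'.dom : Scheme.{u})) (qa : T₁ ⟶ (L.dom : Scheme.{u})) (qA : T₁ ⟶ (A : Scheme.{u})),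
      τ₁S ≫ S₀.ι = τ₁ ≫ 𝒳.hom ∧
      q' ≫ L'.dom.ι ≫ (fst 𝒱 𝒱).left = τ₁ ≫ j.left ∧ q' ≫ L'.dom.ι ≫ (snd 𝒱 𝒱).left = τ₁S ≫ qu ≫ L'.mul ∧
      qa ≫ L.dom.ι ≫ (fst 𝒳 𝒳).left = τ₁ ∧ qa ≫ L.dom.ι ≫ (snd 𝒳 𝒳).left = τ₁ ≫ 𝒳.hom ≫ s ∧
      qA ≫ A.ι = τ₁ ≫ j.left ∧
      qy ≫ L'.dom.ι ≫ (fst 𝒱 𝒱).left = qa ≫ L.mul ≫ j.left ∧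
      qy ≫ L'.dom.ι ≫ (snd 𝒱 𝒱).left = τ₁ ≫ 𝒳.hom ≫ (y₀ ≫ j.left) by
    exact L.sectionSlice_mem_domain_comp_of_chart L' j φ hφ₁ hφ₂ i₁ i₂ s hs σ' hσ'1 hσ'2 e ρ he hρ hρS hglue
      (y₀ ≫ j.left) hy S₀ qu hqu₁ hqu₂ (𝒳₁.ι ≫ 𝒳₀.ι) (𝒳₁.ι ≫ κ₀) hτS q hq₁ hq₂ hne ⟨⟨x, hx₀⟩, hx₁⟩
  -- ### Step 4 (layer C1b): THE NON-EMPTINESS CONFIGURATION from strictness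
  -- `V₁ = {a ∈ 𝒳₁ : (a, s) ∈ dom}`, `V₂ = {a ∈ V₁ : (j(a·s), y) ∈ dom′}`, `T₁ := V₂`
  set τ : (𝒳₁ : Scheme.{u}) ⟶ 𝒳.left := 𝒳₁.ι ≫ 𝒳₀.ι with hτdef
  set V₁ : (𝒳₁ : Scheme.{u}).Opens := τ ⁻¹ᵁ (σX.left ⁻¹ᵁ L.dom) with hV₁def
  obtain ⟨qa₁, hqa₁⟩ : ∃ qa₁ : (V₁ : Scheme.{u}) ⟶ (L.dom : Scheme.{u}), qa₁ ≫ L.dom.ι = V₁.ι ≫ τ ≫ σX.left :=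
    exists_lift_opens' L.dom (V₁.ι ≫ τ ≫ σX.left) fun w => w.2
  obtain ⟨ν, hν1, hν2⟩ : ∃ ν : (V₁ : Scheme.{u}) ⟶ (𝒱 ⊗ 𝒱).left,
      ν ≫ (fst 𝒱 𝒱).left = qa₁ ≫ L.mul ≫ j.left ∧ ν ≫ (snd 𝒱 𝒱).left = V₁.ι ≫ τ ≫ 𝒳.hom ≫ y₀ ≫ j.left := by
    have w : (qa₁ ≫ L.mul ≫ j.left) ≫ 𝒱.hom = (V₁.ι ≫ τ ≫ 𝒳.hom ≫ y₀ ≫ j.left) ≫ 𝒱.hom := by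
      simp only [Category.assoc]
      rw [hjS, L.mul_comp, reassoc_of% hqa₁, hσXS, hy₀, Category.comp_id]
    exact ⟨pullback.lift _ _ w, pullback.lift_fst _ _ _, pullback.lift_snd _ _ _⟩
  set V₂ : (V₁ : Scheme.{u}).Opens := ν ⁻¹ᵁ L'.dom with hV₂def
  obtain ⟨qy, hqy⟩ : ∃ qy : (V₂ : Scheme.{u}) ⟶ (L'.dom : Scheme.{u}), qy ≫ L'.dom.ι = V₂.ι ≫ ν :=
    exists_lift_opens' L'.dom (V₂.ι ≫ ν) fun w => w.2
  -- `τ₁ := V₂.ι ≫ V₁.ι ≫ τ` and its slice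
  have hτσ : (V₂.ι ≫ V₁.ι ≫ τ) ≫ σX.left = (V₂.ι ≫ qa₁) ≫ L.dom.ι := by
    simp only [Category.assoc]
    rw [hqa₁]
  -- `j a ∈ A` for `(a, s) ∈ dom`: `σ′ ∘ j = (j ⊗ j) ∘ σX`
  have hσ'j : j.left ≫ σ' = σX.left ≫ (j ⊗ₘ j).left := by
    refine hextV _ _ ?_ ?_
    · rw [Category.assoc, hσ'1, Category.comp_id, Category.assoc, hjj1, reassoc_of% hσX1]
    · rw [Category.assoc, hσ'2, reassoc_of% hjS, Category.assoc, hjj2, reassoc_of% hσX2]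
  obtain ⟨qA, hqA⟩ : ∃ qA : (V₂ : Scheme.{u}) ⟶ (A : Scheme.{u}), qA ≫ A.ι = (V₂.ι ≫ V₁.ι ≫ τ) ≫ j.left := by
    refine exists_lift_opens' A _ fun p => hA _ ?_
    rw [base_comp_apply' (show ((V₂.ι ≫ V₁.ι ≫ τ) ≫ j.left) ≫ σ' = (V₂.ι ≫ qa₁) ≫ φ ≫ L'.dom.ι from by
      rw [Category.assoc, hσ'j, ← Category.assoc, hτσ, Category.assoc, hφ₁])]
    exact (((V₂.ι ≫ qa₁) ≫ φ).base p).2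
  -- `T₁ = V₂` is non-empty: a point of the irreducible fibre `𝒳_t` in three opens
  have hV₂ne : Nonempty (V₂ : Scheme.{u}) := by
    -- (n3) the open `O₃ = {a : (a, s) ∈ dom, (j(a·s), y) ∈ dom′}` of `𝒳`, through the translate `a ↦ a·s`
    set D₁ : 𝒳.left.Opens := σX.left ⁻¹ᵁ L.dom with hD₁def
    obtain ⟨qa₀, hqa₀⟩ : ∃ qa₀ : (D₁ : Scheme.{u}) ⟶ (L.dom : Scheme.{u}), qa₀ ≫ L.dom.ι = D₁.ι ≫ σX.left :=
      exists_lift_opens' L.dom (D₁.ι ≫ σX.left) fun w => w.2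
    obtain ⟨ν₀, hν₀1, hν₀2⟩ : ∃ ν₀ : (D₁ : Scheme.{u}) ⟶ (𝒱 ⊗ 𝒱).left,
        ν₀ ≫ (fst 𝒱 𝒱).left = qa₀ ≫ L.mul ≫ j.left ∧ ν₀ ≫ (snd 𝒱 𝒱).left = D₁.ι ≫ 𝒳.hom ≫ y₀ ≫ j.left := by
      have w : (qa₀ ≫ L.mul ≫ j.left) ≫ 𝒱.hom = (D₁.ι ≫ 𝒳.hom ≫ y₀ ≫ j.left) ≫ 𝒱.hom := by
        simp only [Category.assoc]
        rw [hjS, L.mul_comp, reassoc_of% hqa₀, hσXS, hy₀, Category.comp_id]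
      exact ⟨pullback.lift _ _ w, pullback.lift_fst _ _ _, pullback.lift_snd _ _ _⟩
    set O₃ : (D₁ : Scheme.{u}).Opens := ν₀ ⁻¹ᵁ L'.dom with hO₃def
    -- `ν = ξ ≫ ν₀` on `V₁`, `ξ` the inclusion `V₁ → D₁`
    obtain ⟨ξ, hξ⟩ : ∃ ξ : (V₁ : Scheme.{u}) ⟶ (D₁ : Scheme.{u}), ξ ≫ D₁.ι = V₁.ι ≫ τ :=
      exists_lift_opens' D₁ (V₁.ι ≫ τ) fun w => w.2
    have hξqa : ξ ≫ qa₀ = qa₁ := by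
      rw [← cancel_mono L.dom.ι, Category.assoc, hqa₀, reassoc_of% hξ, hqa₁]
    have hνξ : ν = ξ ≫ ν₀ := by
      refine hextV _ _ ?_ ?_
      · rw [Category.assoc ξ, hν₀1, reassoc_of% hξqa, hν1]
      · rw [Category.assoc ξ, hν₀2, reassoc_of% hξ, hν2]
    -- (n3) is non-empty in the fibre `𝒳_t`: the slice of `y` on `𝒱`, strictness of `L′`, density of `j(𝒳)`, and the
    -- fibrewise-dense image of the translate `ρₓ : a ↦ a·s` of `L`
    set σy : 𝒱 ⟶ 𝒱 ⊗ 𝒱 := lift (𝟙 𝒱) (Over.homMk (𝒱.hom ≫ (y₀ ≫ j.left))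
      (by rw [Category.assoc, hy, Category.comp_id])) with hσydef
    have hσy2 : σy.left ≫ (snd 𝒱 𝒱).left = 𝒱.hom ≫ (y₀ ≫ j.left) := by
      change (σy ≫ snd 𝒱 𝒱).left = _; rw [hσydef, lift_snd]; rfl
    have hσy1 : σy.left ≫ (fst 𝒱 𝒱).left = 𝟙 _ := by
      change (σy ≫ fst 𝒱 𝒱).left = _; rw [hσydef, lift_fst]; rfl
    set Dy : 𝒱.left.Opens := σy.left ⁻¹ᵁ L'.dom with hDydef
    obtain ⟨⟨hdfst', hdsnd'⟩, -, -⟩ := hL'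
    have hDyt : ((Dy : Set 𝒱.left) ∩ 𝒱.hom.base ⁻¹' {t}).Nonempty := by
      have hw₀ : (snd 𝒱 𝒱).left.base (σy.left.base (j.left.base x)) = (y₀ ≫ j.left).base t := by
        rw [base_comp_apply' hσy2, htdef, ← base_comp_apply' hjS]
        rfl
      obtain ⟨w, hwdom, hwt⟩ := hdsnd'.nonempty_inter_fibre ⟨_, hw₀⟩
      obtain ⟨v, hv, hvt⟩ := exists_sectionSlice_eq 𝒱 (y₀ ≫ j.left) hy w t hwt
      refine ⟨v, ?_, hvt⟩
      change σy.left.base v ∈ L'.dom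
      rw [hv]
      exact hwdom
    obtain ⟨_, ⟨hvDy, a', rfl⟩, ha't⟩ := nonempty_inter_of_fibrewiseDense hjd Dy.2 hDyt
    obtain ⟨Aₓ, eₓ, ρₓ, heₓ, hρₓ, hρₓo, hρₓS, hAₓ, -, -, hdens⟩ := L.exists_rightTranslate' s hs
    obtain ⟨-, hρₓd⟩ := hdens hL hirr
    obtain ⟨_, ⟨ha'', b, rfl⟩, hbt⟩ := nonempty_inter_of_fibrewiseDense hρₓd (j.left ⁻¹ᵁ Dy).2 (t := t)
      ⟨a', hvDy, by change 𝒳.hom.base a' = t; rw [← base_comp_apply' hjS]; exact ha't⟩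
    -- the point `a = Aₓ.ι b` lies in `O₃` and in `𝒳_t`
    obtain ⟨ξₓ, hξₓ⟩ : ∃ ξₓ : (Aₓ : Scheme.{u}) ⟶ (D₁ : Scheme.{u}), ξₓ ≫ D₁.ι = Aₓ.ι :=
      exists_lift_opens' D₁ Aₓ.ι fun c => (hAₓ _).1 c.2
    have hξₓqa : ξₓ ≫ qa₀ = eₓ := by
      rw [← cancel_mono L.dom.ι, Category.assoc, hqa₀, reassoc_of% hξₓ, heₓ]
    have hν₀ξ : ξₓ ≫ ν₀ = ρₓ ≫ j.left ≫ σy.left := by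
      refine hextV _ _ ?_ ?_
      · rw [Category.assoc, hν₀1, reassoc_of% hξₓqa, hρₓ, Category.assoc, Category.assoc, Category.assoc, hσy1,
          Category.comp_id]
      · rw [Category.assoc, hν₀2, reassoc_of% hξₓ, Category.assoc, Category.assoc, hσy2, ← reassoc_of% hρₓS,
          reassoc_of% hjS]
    have hbO₃ : ξₓ.base b ∈ O₃ := by
      change ν₀.base (ξₓ.base b) ∈ L'.dom
      rw [base_comp_apply' hν₀ξ]
      exact ha''
    have hat : 𝒳.hom.base (Aₓ.ι.base b) = t := by
      change (Aₓ.ι ≫ 𝒳.hom).base b = t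
      rw [← base_comp_apply' hρₓS]
      exact hbt
    -- the three opens meet in the irreducible fibre `𝒳_t`
    have hO₁t : (𝒳.hom.base ⁻¹' {t} ∩ Set.range τ.base).Nonempty :=
      ⟨x, rfl, ⟨⟨x, hx₀⟩, hx₁⟩, rfl⟩
    have hO₃t : (𝒳.hom.base ⁻¹' {t} ∩ Set.range (O₃.ι ≫ D₁.ι).base).Nonempty :=
      ⟨Aₓ.ι.base b, hat, ⟨ξₓ.base b, hbO₃⟩, base_comp_apply' hξₓ b⟩
    obtain ⟨a, -, ⟨p₁, hp₁⟩, ⟨d₁, hd₁⟩⟩ := hirr t _ _ τ.isOpenEmbedding.isOpen_range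
      (O₃.ι ≫ D₁.ι).isOpenEmbedding.isOpen_range hO₁t hO₃t
    -- `p₁ ∈ V₁` and `∈ V₂`
    have hp₁V₁ : p₁ ∈ V₁ := by
      change σX.left.base (τ.base p₁) ∈ L.dom
      rw [hp₁, ← hd₁]
      exact (O₃.ι.base d₁).2
    have hξp : ξ.base ⟨p₁, hp₁V₁⟩ = O₃.ι.base d₁ := by
      apply D₁.ι.isOpenEmbedding.injective
      rw [base_comp_apply' hξ]
      change τ.base p₁ = (O₃.ι ≫ D₁.ι).base d₁
      rw [hp₁, hd₁]
    refine ⟨⟨⟨p₁, hp₁V₁⟩, ?_⟩⟩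
    change ν.base ⟨p₁, hp₁V₁⟩ ∈ L'.dom
    rw [hνξ, Scheme.Hom.comp_base, TopCat.coe_comp, Function.comp_apply, hξp]
    exact d₁.2
  -- assemble `hne`
  refine ⟨V₂, hV₂ne, V₂.ι ≫ V₁.ι ≫ τ, V₂.ι ≫ V₁.ι ≫ 𝒳₁.ι ≫ κ₀, V₂.ι ≫ V₁.ι ≫ q, qy, V₂.ι ≫ qa₁, qA,
    ?_, ?_, ?_, ?_, ?_, hqA, ?_, ?_⟩
  · simp only [Category.assoc]
    rw [hκ₀, hτdef, Category.assoc]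
  · simp only [Category.assoc]
    rw [hq₁, hτdef, Category.assoc]
  · simp only [Category.assoc]
    rw [hq₂, Category.assoc]
  · simp only [Category.assoc]
    rw [reassoc_of% hqa₁, hσX1, Category.comp_id]
  · simp only [Category.assoc]
    rw [reassoc_of% hqa₁, hσX2]
  · rw [reassoc_of% hqy, hν1, Category.assoc]
  · rw [reassoc_of% hqy, hν2]
    simp only [Category.assoc]

end Literature.AlgebraicGeometry.GroupSchemes

end
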